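import Literature.Probability.LatticeModels.AnisotropicPlaneRotatorTorusBoxCriterion
import Literature.Probability.LatticeModels.AnisotropicInfraredConstantLog
import HarnessLib

/-!
# The periodic susceptibility of the LAYERED plane rotator on `(ℤ/Lℤ)³`: interlayer coupling can only lower the
# susceptibility-divergence threshold, and `T_χ^{3D,per}(J∥, J⊥) → T_χ^{2D}(J∥)` as `J⊥ → 0`

Topic `Literature/Probability/LatticeModels`. J. Ginibre, Comm. Math. Phys. **16** (1970) 310 (monotonicity of rotator
correlations in the ferromagnetic couplings) [Ginibre1970]; E. H. Lieb, Comm. Math. Phys. **77** (1980) 127, eq. (23),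
Theorem 4 and p. 128 (boxes: the finite algorithm), B. Simon, ibid. 111, Thm 1.3 [Lieb1980] [Simon1980CMP]; the layered
couplings `(J, J, εJ)` of L. L. Liu, H. E. Stanley [LiuStanley1972]; S. Friedli, Y. Velenik (CUP 2017) §3.1 (periodic
boxes) [FriedliVelenik2017].

This is the periodic twin of `LayeredPlaneRotatorSusceptibility.lean` (free boundary conditions / infinite volume:
`infTwoPointLayered`, `summable_layer_of_summable_layered`, `summable_layer_iff_summable_layered_weak`), written on the
object of the reflection-positivity floors — the angle-cube two-point function `AnisotropicRotator.corr` of the layered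
rotator `(βJ∥, βJ∥, βJ⊥)` on the torus `(ℤ/Lℤ)³` and its **periodic susceptibility**
`χ^{3D,per}_L(x) = ∑_y corr (βJ∥, βJ∥, βJ⊥) x y` — using the torus slab criterion of
`AnisotropicPlaneRotatorTorusBoxCriterion.lean` and the two-dimensional equivalence of
`PlaneRotatorPeriodicSusceptibility.lean`'s pattern.

* §1 **Ginibre: a free layered box inside the layered torus** (`volTwoPointLayered_box_le_corr`): for `2n + 3 ≤ L` and
  `x, y ∈ [−n,n]³`, `G^{free}_{[−n,n]³; β,J∥,J⊥}(x,y) ≤ corr (βJ∥, βJ∥, βJ⊥) (πx) (πy)`; summed over the box.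
* §2 **Bounded periodic susceptibility ⇒ summable free two-point functions, in 3D AND in the layer**
  (`summable_infTwoPointLayered_of_torus_susceptibility_le`, `summable_layer_of_torus_susceptibility_le`,
  `exists_nnBoxShellSum_lt_one_of_torus_susceptibility_le`): `χ^{3D,per}_L(0) ≤ B` for all large `L` ⇒
  `∑_z G^{3D,free,∞}(0,z) ≤ B` ⇒ `∑_x G^{2D,free,∞}_{βJ∥}(0,x) < ∞` ⇒ Lieb's algorithm terminates in the plane at `βJ∥`
  — for EVERY `J⊥ ≥ 0`. Contrapositives: where the single layer's free susceptibility diverges, or where its helicity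
  modulus survives (`βΥ_{L+1}(βJ∥) ↛ 0`), the stack's periodic susceptibility is unbounded for every interlayer coupling
  (`torus_susceptibility_unbounded_of_not_summable_layer`, `…_of_not_tendsto_torusXYStiffness_layer`).
* §3 **The converse at weak coupling** (`exists_torus_susceptibility_bound_of_summable_layer`, with the slab criterion of
  `AnisotropicPlaneRotatorTorusBoxCriterion.lean`): if `∑_x G^{2D,free,∞}_{K₀}(0,x) < ∞` then there are `δ > 0`, `C`, `L₁`
  with `χ^{3D,per}_L(x) ≤ C` for all `β, J∥, J⊥ ≥ 0` with `βJ∥ ≤ K₀`, `βJ⊥ ≤ δ`, all `L ≥ L₁` and all `x`; hence the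
  weak-coupling equivalence `torus_susceptibility_bounded_weak_iff_summable_layer`.
* §4 **Long-range order makes the periodic susceptibility diverge** (`exists_sum_corr_ge_of_le_plateau`: `δ ≤ plateau_L ⇒
  ∃x, δ·L³ ≤ χ^{3D,per}_L(x)`), and with the Fröhlich–Israel–Lieb–Simon / Kennedy–Lieb–Shastry floor of
  `AnisotropicInfraredConstantLog.lean`: for `0 < K⊥ ≤ K∥` with `K∥ > 1 + ln(K∥/K⊥)/(2π)` the periodic susceptibility
  exceeds every bound along large even `L` (`torus_susceptibility_unbounded_of_log_floor`).

In words (classical layered XY comparison model of the `hubbard-tc` cell, MO-S3 2D→3D grammar): for the PERIODIC layered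
rotator, interlayer coupling can only LOWER the susceptibility-divergence threshold —
`T_χ^{3D,per}(J∥, J⊥) ≥ T_χ^{2D}(J∥)` for every `J⊥ ≥ 0` — and `T_χ^{3D,per}(J∥, J⊥) → T_χ^{2D}(J∥)` as `J⊥ → 0`; torus
long-range order forces `χ^{3D,per}_L → ∞`.

## What this is not

Classical comparison model only; statements about susceptibility thresholds of the periodic rotator, not a `T_c` and not
a Kosterlitz–Thouless window; no number asserted; nothing electronic.
-/

noncomputable section

open MeasureTheory Finset Filter
open scoped BigOperators Topology

namespace Literature.Probability.LatticeModels

namespace AnisotropicRotator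

open PlaneRotator Literature.Barriers.CriticalPhenomena Literature.Barriers.CriticalPhenomena.LongRangeIsing
open Literature.MathematicalPhysics.QuantumLattice

/- As in `AnisotropicPlaneRotatorTorusBoxCriterion.lean` §4–§6: `corr`/`plateau` fix the global Borel structure of `Circle`;
the instance-generic free-box theorems are used at that instance. -/

variable {L : ℕ} [NeZero L]

/-! ## §1 Ginibre: a free layered box inside the layered torus -/

section FreeInTorus

/-- **The projected bond carries the layered coupling**: for `L ≥ 3`, the symmetrised torus coupling of
`(π x, π(x + eᵢ))` and of `(π(x + eᵢ), π x)` is `K_i/2`. [cite: Ginibre1970, Example 4 (plane rotators, general couplings J_A)] -/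
theorem torusXY_symmCoupling_proj_add_single (hL : 3 ≤ L) (K : Fin 3 → ℝ) (x : Site 3) (i : Fin 3) :
    symmCoupling ((torusXY 3 L).pairCoupling fun b => K b.2) (Torus.proj L x, Torus.proj L (x + Pi.single i 1)) = K i / 2 ∧
      symmCoupling ((torusXY 3 L).pairCoupling fun b => K b.2) (Torus.proj L (x + Pi.single i 1), Torus.proj L x) =
        K i / 2 := by
  rw [torusProj_add_single_one]
  exact torusXY_symmCoupling_add_single hL K (Torus.proj L x) i

/-- **Ginibre's comparison: a free layered box inside the layered torus.** For `β, J∥, J⊥ ≥ 0`, `2n + 3 ≤ L` and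
`x, y ∈ [−n,n]³`:

  `G^{free}_{[−n,n]³; β, J∥, J⊥}(x, y) ≤ corr (βJ∥, βJ∥, βJ⊥) (π x) (π y)`,

`π` the reduction mod `L` (injective on the box): the periodic model is the free box plus further ferromagnetic bonds and
rotators (embedding comparison `twoPoint_le_of_embedding`; on bonds the two layered grammars agree,
`pairLayeredCoupling_self_add_single`). [cite: Ginibre1970, Prop. 3 with Example 4 (plane rotators); LiuStanley1972, p. 272 (layers (J, J, εJ)); FriedliVelenik2017, §3.1 (boxes, periodic boundary condition)] -/
theorem volTwoPointLayered_box_le_corr {β Jp Jz : ℝ} (hβ : 0 ≤ β) (hp : 0 ≤ Jp) (hz : 0 ≤ Jz) {n : ℕ}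
    (hL : 2 * n + 3 ≤ L) {x y : Site 3} (hx : x ∈ box 3 n) (hy : y ∈ box 3 n) :
    volTwoPointLayered β Jp Jz (box 3 n) x y ≤
      corr (layeredCoupling (β * Jp) (β * Jz)) (Torus.proj L x) (Torus.proj L y) := by
  have hL2 : 2 * n < L := by omega
  have hL3 : 3 ≤ L := by omega
  rw [volTwoPointLayered_of_mem β Jp Jz hx hy, corr_eq_twoPoint,
    ← twoPoint_symmCoupling ((torusXY 3 L).pairCoupling fun b => layeredCoupling (β * Jp) (β * Jz) b.2)]
  have hinj : Function.Injective fun z : box 3 n => Torus.proj L (z : Site 3) := fun u v huv =>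
    Subtype.ext (torusProj_injOn_box_of_lt hL2 u.2 v.2 huv)
  have hK : ∀ i, 0 ≤ layeredCoupling (β * Jp) (β * Jz) i :=
    fun i => layeredCoupling_nonneg (mul_nonneg hβ hp) (mul_nonneg hβ hz) i
  refine twoPoint_le_of_embedding (τ := fun z : box 3 n => Torus.proj L (z : Site 3)) hinj
    (J₀ := layeredXYCoupling β Jp Jz (box 3 n)) (layeredXYCoupling_nonneg hβ hp hz (box 3 n))
    (torusXY_symmCoupling_fun_nonneg hK) (fun u v => ?_) ⟨x, hx⟩ ⟨y, hy⟩
  show β / 2 * LongRangeIsing.layeredCoupling Jp Jz (u : Site 3) (v : Site 3) ≤ _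
  by_cases h0 : LongRangeIsing.layeredCoupling Jp Jz (u : Site 3) (v : Site 3) = 0
  · rw [h0, mul_zero]
    exact torusXY_symmCoupling_fun_nonneg hK _
  · -- a bond: `u − v = ±eᵢ`
    have h1 : l1Norm ((u : Site 3) - (v : Site 3)) = 1 := by
      by_contra h
      exact h0 (by unfold LongRangeIsing.layeredCoupling; rw [if_neg h])
    obtain ⟨i, hi⟩ := eq_single_or_of_l1Norm_eq_one h1
    have hval := torusXY_symmCoupling_proj_add_single hL3 (layeredCoupling (β * Jp) (β * Jz)) (L := L)
    rcases hi with hi | hi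
    · -- `u = v + eᵢ`
      have hu : (u : Site 3) = (v : Site 3) + Pi.single i 1 := by rw [← hi]; abel
      rw [hu, (pairLayeredCoupling_self_add_single Jp Jz (v : Site 3) i).2, (hval (v : Site 3) i).2,
        layeredCoupling_mul]
      exact le_of_eq (by ring)
    · -- `v = u + eᵢ`
      have hv : (v : Site 3) = (u : Site 3) + Pi.single i 1 := by
        have : (u : Site 3) - (v : Site 3) = -Pi.single i 1 := hi
        rw [sub_eq_iff_eq_add] at this; rw [this]; abel
      rw [hv, (pairLayeredCoupling_self_add_single Jp Jz (u : Site 3) i).1, (hval (u : Site 3) i).1,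
        layeredCoupling_mul]
      exact le_of_eq (by ring)

/-- **The free-box susceptibility is below the periodic one**: for `β, J∥, J⊥ ≥ 0` and `2n + 3 ≤ L`,
`∑_{x ∈ [−n,n]³} G^{free}_{[−n,n]³}(0, x) ≤ χ^{3D,per}_L(0) = ∑_y corr (βJ∥, βJ∥, βJ⊥) 0 y`.
[cite: Ginibre1970, Prop. 3 with Example 4 (plane rotators); FriedliVelenik2017, §3.1 (boxes, periodic boundary condition)] -/
theorem sum_volTwoPointLayered_box_le_torus_susceptibility {β Jp Jz : ℝ} (hβ : 0 ≤ β) (hp : 0 ≤ Jp) (hz : 0 ≤ Jz)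
    {n : ℕ} (hL : 2 * n + 3 ≤ L) :
    ∑ x ∈ box 3 n, volTwoPointLayered β Jp Jz (box 3 n) 0 x ≤
      ∑ y : TorusSite 3 L, corr (layeredCoupling (β * Jp) (β * Jz)) 0 y := by
  classical
  have hinj : Set.InjOn (Torus.proj (d := 3) L) (box 3 n : Set (Site 3)) := torusProj_injOn_box_of_lt (by omega)
  have h0 : Torus.proj L (0 : Site 3) = (0 : TorusSite 3 L) := by funext i; simp
  have hK : ∀ i, 0 ≤ layeredCoupling (β * Jp) (β * Jz) i :=
    fun i => layeredCoupling_nonneg (mul_nonneg hβ hp) (mul_nonneg hβ hz) i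
  calc ∑ x ∈ box 3 n, volTwoPointLayered β Jp Jz (box 3 n) 0 x
      ≤ ∑ x ∈ box 3 n, corr (layeredCoupling (β * Jp) (β * Jz)) (0 : TorusSite 3 L) (Torus.proj L x) := by
        refine Finset.sum_le_sum fun x hx => ?_
        have h := volTwoPointLayered_box_le_corr (L := L) hβ hp hz hL (zero_mem_box 3 n) hx
        rwa [h0] at h
    _ = ∑ y ∈ (box 3 n).image (Torus.proj L), corr (layeredCoupling (β * Jp) (β * Jz)) (0 : TorusSite 3 L) y := by
        rw [Finset.sum_image hinj]
    _ ≤ ∑ y : TorusSite 3 L, corr (layeredCoupling (β * Jp) (β * Jz)) 0 y :=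
        Finset.sum_le_sum_of_subset_of_nonneg (Finset.subset_univ _) fun y _ _ => corr_nonneg hK _ _

end FreeInTorus

/-! ## §2 Bounded periodic susceptibility ⇒ summable free two-point functions (3D and the layer) -/

section PeriodicToFree

/-- **Eventually bounded periodic susceptibility bounds the infinite-volume free susceptibility of the stack**: if
`χ^{3D,per}_L(0) ≤ B` for all `L ≥ L₀` then `∑_z G^{3D,free,∞}_{β;J∥,J⊥}(0,z)` converges and is `≤ B` (free boxes increase
to the infinite-volume free two-point function, each inside a large torus). [cite: Ginibre1970, Prop. 3 with Example 4 (plane rotators); Simon1980CMP, Thm 1.3 (summable two-point function)] -/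
theorem summable_infTwoPointLayered_of_torus_susceptibility_le {β Jp Jz : ℝ} (hβ : 0 ≤ β) (hp : 0 ≤ Jp) (hz : 0 ≤ Jz)
    {B : ℝ} {L₀ : ℕ}
    (h : ∀ (L : ℕ) [NeZero L], L₀ ≤ L → ∑ y : TorusSite 3 L, corr (layeredCoupling (β * Jp) (β * Jz)) 0 y ≤ B) :
    Summable (fun z : Site 3 => infTwoPointLayered β Jp Jz 0 z) ∧ ∑' z : Site 3, infTwoPointLayered β Jp Jz 0 z ≤ B := by
  classical
  have hpart : ∀ F : Finset (Site 3), ∑ z ∈ F, infTwoPointLayered β Jp Jz 0 z ≤ B := by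
    intro F
    have hlim : Tendsto (fun n : ℕ => ∑ z ∈ F, volTwoPointLayered β Jp Jz (box 3 n) 0 z) atTop
        (𝓝 (∑ z ∈ F, infTwoPointLayered β Jp Jz 0 z)) :=
      tendsto_finsetSum F fun z _ => tendsto_volTwoPointLayered_box hβ hp hz 0 z
    refine le_of_tendsto' hlim fun n => ?_
    set L : ℕ := max (2 * n + 3) L₀ with hLdef
    haveI : NeZero L := ⟨by positivity⟩
    have hL : 2 * n + 3 ≤ L := le_max_left _ _
    have hL₀ : L₀ ≤ L := le_max_right _ _
    calc ∑ z ∈ F, volTwoPointLayered β Jp Jz (box 3 n) 0 z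
        ≤ ∑ z ∈ box 3 n, volTwoPointLayered β Jp Jz (box 3 n) 0 z := by
          rw [← Finset.sum_filter_add_sum_filter_not F (fun z => z ∈ box 3 n)]
          have hzero : ∑ z ∈ F.filter (fun z => z ∉ box 3 n), volTwoPointLayered β Jp Jz (box 3 n) 0 z = 0 :=
            Finset.sum_eq_zero fun z hz' => by
              unfold volTwoPointLayered
              rw [dif_neg (fun h => (Finset.mem_filter.1 hz').2 h.2)]
          rw [hzero, add_zero]
          exact Finset.sum_le_sum_of_subset_of_nonneg (fun z hz' => (Finset.mem_filter.1 hz').2)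
            fun z _ _ => volTwoPointLayered_nonneg hβ hp hz _ _ _
      _ ≤ ∑ y : TorusSite 3 L, corr (layeredCoupling (β * Jp) (β * Jz)) 0 y :=
          sum_volTwoPointLayered_box_le_torus_susceptibility hβ hp hz hL
      _ ≤ B := h L hL₀
  have hsum : Summable (fun z : Site 3 => infTwoPointLayered β Jp Jz 0 z) :=
    summable_of_sum_le (fun z => infTwoPointLayered_nonneg hβ hp hz 0 z) hpart
  exact ⟨hsum, hsum.tsum_le_of_sum_le hpart⟩

/-- **… and of the single layer**, for every interlayer coupling: under the same hypothesis
`∑_x G^{2D,free,∞}_{βJ∥}(0,x) < ∞` (tree: a layer sits below the stack, `summable_layer_of_summable_layered`).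
[cite: Ginibre1970, Prop. 3 with Example 4 (plane rotators); Simon1980CMP, Thm 1.3] -/
theorem summable_layer_of_torus_susceptibility_le {β Jp Jz : ℝ} (hβ : 0 ≤ β) (hp : 0 ≤ Jp) (hz : 0 ≤ Jz)
    {B : ℝ} {L₀ : ℕ}
    (h : ∀ (L : ℕ) [NeZero L], L₀ ≤ L → ∑ y : TorusSite 3 L, corr (layeredCoupling (β * Jp) (β * Jz)) 0 y ≤ B) :
    Summable (fun x : Site 2 => infTwoPoint (β * Jp) 2 0 x) :=
  summable_layer_of_summable_layered hβ hp hz (summable_infTwoPointLayered_of_torus_susceptibility_le hβ hp hz h).1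

/-- **… so Lieb's algorithm terminates in the plane at `βJ∥`**: `∃ R ≥ 1, S_R(βJ∥) < 1` (tree `summable_infTwoPoint_iff`).
[cite: Lieb1980, Theorem 4 and p. 128 (boxes; finite algorithm); Simon1980CMP, Thm 1.3] -/
theorem exists_nnBoxShellSum_lt_one_of_torus_susceptibility_le {β Jp Jz : ℝ} (hβ : 0 ≤ β) (hp : 0 ≤ Jp) (hz : 0 ≤ Jz)
    {B : ℝ} {L₀ : ℕ}
    (h : ∀ (L : ℕ) [NeZero L], L₀ ≤ L → ∑ y : TorusSite 3 L, corr (layeredCoupling (β * Jp) (β * Jz)) 0 y ≤ B) :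
    ∃ R : ℕ, 1 ≤ R ∧ nnBoxShellSum (β * Jp) 2 R < 1 :=
  (summable_infTwoPoint_iff (mul_nonneg hβ hp)).1 (summable_layer_of_torus_susceptibility_le hβ hp hz h)

/-- **Interlayer coupling cannot make the periodic susceptibility finite where the layer's free susceptibility
diverges**: if `∑_x G^{2D,free,∞}_{βJ∥}(0,x) = ∞` then for EVERY `J⊥ ≥ 0`, every `B` and `L₀` there is `L ≥ L₀` with
`χ^{3D,per}_L(0) > B`. [cite: Ginibre1970, Prop. 3 with Example 4 (plane rotators); Simon1980CMP, Thm 1.3] -/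
theorem torus_susceptibility_unbounded_of_not_summable_layer {β Jp Jz : ℝ} (hβ : 0 ≤ β) (hp : 0 ≤ Jp) (hz : 0 ≤ Jz)
    (hnot : ¬ Summable (fun x : Site 2 => infTwoPoint (β * Jp) 2 0 x)) (B : ℝ) (L₀ : ℕ) :
    ∃ (L : ℕ) (_ : NeZero L), L₀ ≤ L ∧ B < ∑ y : TorusSite 3 L, corr (layeredCoupling (β * Jp) (β * Jz)) 0 y := by
  by_contra hcon
  push Not at hcon
  exact hnot (summable_layer_of_torus_susceptibility_le hβ hp hz (B := B) (L₀ := L₀)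
    fun L _ hL => hcon L inferInstance hL)

/-- **A surviving single-layer helicity modulus makes the stack's periodic susceptibility diverge**, for every
interlayer coupling: `βΥ_{L+1}(βJ∥) ↛ 0 ⇒ χ^{3D,per}_L(0)` unbounded in `L` (tree: `Υ ↛ 0 ⇒` the layer's free two-point
function is not summable). [cite: Lieb1980, Theorem 4 and p. 128 (boxes); Simon1980CMP, Thm 1.3; Ginibre1970, Prop. 3 with Example 4 (plane rotators)] -/
theorem torus_susceptibility_unbounded_of_not_tendsto_torusXYStiffness_layer {β Jp Jz : ℝ} (hβ : 0 ≤ β)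
    (hp : 0 ≤ Jp) (hz : 0 ≤ Jz)
    (hnot : ¬ Tendsto (fun L : ℕ => torusXYStiffness (L + 1) (β * Jp)) atTop (𝓝 0)) (B : ℝ) (L₀ : ℕ) :
    ∃ (L : ℕ) (_ : NeZero L), L₀ ≤ L ∧ B < ∑ y : TorusSite 3 L, corr (layeredCoupling (β * Jp) (β * Jz)) 0 y :=
  torus_susceptibility_unbounded_of_not_summable_layer hβ hp hz
    (not_summable_infTwoPoint_of_not_tendsto_torusXYStiffness (mul_nonneg hβ hp) hnot) B L₀

end PeriodicToFree

/-! ## §3 The converse at weak interlayer coupling: a summable layer bounds the stack's periodic susceptibility -/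

section FreeToPeriodic

/-- **Row sums from a pointwise box bound**: if `corr K x y ≤ m^{aIndex (R,R,1) (coord_y x)}` for all `x, y` with
`0 ≤ m < 1`, then every row of the periodic susceptibility is `≤ ∑_{z ∈ ℤ³} m^{⌊‖z‖_∞/R⌋}`.
[cite: Simon1980CMP, Thm 1.3 (exponential decay summed over the lattice)] -/
theorem sum_corr_le_tsum_of_corr_le_pow {K : Fin 3 → ℝ} {R : ℕ} (hR : 1 ≤ R) {m : ℝ} (hm0 : 0 ≤ m) (hm1 : m < 1)
    (h : ∀ x y : TorusSite 3 L, corr K x y ≤ m ^ aIndex (slabRadii R) (fun i => ((x - y) i).valMinAbs))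
    (x : TorusSite 3 L) :
    ∑ y : TorusSite 3 L, corr K x y ≤ ∑' z : Site 3, m ^ (Site.supNorm z / R) := by
  refine (Finset.sum_le_sum fun y _ => h x y).trans ?_
  have e : ∀ y : TorusSite 3 L, aIndex (slabRadii R) (fun i => ((x - y) i).valMinAbs) =
      aIndex (slabRadii R) (fun i => ((y - x) i).valMinAbs) := fun y =>
    aIndex_congr_natAbs _ fun i => natAbs_valMinAbs_coord_comm x y i
  simp only [e]
  exact sum_pow_aIndex_coord_le_tsum hR hm0 hm1 x

/-- **A summable layer bounds the stack's periodic susceptibility at weak interlayer coupling, uniformly in the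
volume.** If `∑_x G^{2D,free,∞}_{K₀}(0,x) < ∞` then there are `δ > 0`, `C ≥ 0` and `L₁` such that for all
`β, J∥, J⊥ ≥ 0` with `βJ∥ ≤ K₀`, `βJ⊥ ≤ δ`, all `L ≥ L₁` and all sites `x`: `χ^{3D,per}_L(x) ≤ C` (Simon–Lieb: the
layer's algorithm terminates at some `R`; the torus slab criterion with `δ = (1 − S_R)/(2(χ^{int}_R + 1))`;
`C = ∑_z ((1+S_R)/2)^{⌊‖z‖_∞/R⌋}`, `L₁ = 2R + 2`). [cite: Lieb1980, eq. (23) and p. 128 (boxes; finite algorithm); Simon1980CMP, Thm 1.3; LiuStanley1972, p. 272 (layers (J, J, εJ))] -/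
theorem exists_torus_susceptibility_bound_of_summable_layer {K₀ : ℝ} (hK0 : 0 ≤ K₀)
    (hG : Summable (fun x : Site 2 => infTwoPoint K₀ 2 0 x)) :
    ∃ (δ C : ℝ) (L₁ : ℕ), 0 < δ ∧ 0 ≤ C ∧
      ∀ β Jp Jz : ℝ, 0 ≤ β → 0 ≤ Jp → 0 ≤ Jz → β * Jp ≤ K₀ → β * Jz ≤ δ →
        ∀ (L : ℕ) [NeZero L], L₁ ≤ L → ∀ x : TorusSite 3 L,
          ∑ y : TorusSite 3 L, corr (layeredCoupling (β * Jp) (β * Jz)) x y ≤ C := by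
  obtain ⟨R, hR, hS⟩ := (summable_infTwoPoint_iff hK0).1 hG
  obtain ⟨δ, s, hδ, hs0, hs1, h⟩ := exists_torus_slabBound_of_nnBoxShellSum_lt_one hK0 hR hS
  refine ⟨δ, ∑' z : Site 3, s ^ (Site.supNorm z / R), 2 * R + 2, hδ, tsum_nonneg fun z => pow_nonneg hs0 _, ?_⟩
  intro β Jp Jz hβ hp hz hKp hKz L _ hL x
  exact sum_corr_le_tsum_of_corr_le_pow hR hs0 hs1 (fun x y => h β Jp Jz hβ hp hz hKp hKz L hL x y) x

/-- **The weak-coupling equivalence on the periodic object.** For `K₀ ≥ 0`: (there is `δ > 0` such that for all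
`β, J∥, J⊥ ≥ 0` with `βJ∥ ≤ K₀`, `βJ⊥ ≤ δ` the periodic susceptibility `χ^{3D,per}_L(0)` is eventually bounded in `L`)
**iff** `∑_x G^{2D,free,∞}_{K₀}(0,x) < ∞` — the single layer's finite-susceptibility phase is the weak-interlayer limit
of the stack's, read on the torus: `lim_{J⊥→0} T_χ^{3D,per}(J∥, J⊥) = T_χ^{2D}(J∥)`.
[cite: Ginibre1970, Prop. 3 with Example 4 (plane rotators); Lieb1980, eq. (23) and p. 128 (boxes; finite algorithm); Simon1980CMP, Thm 1.3] -/
theorem torus_susceptibility_bounded_weak_iff_summable_layer {K₀ : ℝ} (hK0 : 0 ≤ K₀) :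
    (∃ δ : ℝ, 0 < δ ∧ ∀ β Jp Jz : ℝ, 0 ≤ β → 0 ≤ Jp → 0 ≤ Jz → β * Jp ≤ K₀ → β * Jz ≤ δ →
        ∃ (B : ℝ) (L₁ : ℕ), ∀ (L : ℕ) [NeZero L], L₁ ≤ L →
          ∑ y : TorusSite 3 L, corr (layeredCoupling (β * Jp) (β * Jz)) 0 y ≤ B) ↔
      Summable (fun x : Site 2 => infTwoPoint K₀ 2 0 x) := by
  constructor
  · rintro ⟨δ, hδ, h⟩
    obtain ⟨B, L₁, hB⟩ := h 1 K₀ 0 zero_le_one hK0 le_rfl (by rw [one_mul]) (by rw [mul_zero]; exact hδ.le)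
    have hs := summable_layer_of_torus_susceptibility_le zero_le_one hK0 le_rfl hB
    rwa [one_mul] at hs
  · intro hG
    obtain ⟨δ, C, L₁, hδ, -, h⟩ := exists_torus_susceptibility_bound_of_summable_layer hK0 hG
    exact ⟨δ, hδ, fun β Jp Jz hβ hp hz hKp hKz => ⟨C, L₁, fun L _ hL => h β Jp Jz hβ hp hz hKp hKz L hL 0⟩⟩

/-- **The Onsager window on the periodic object**: for `0 ≤ K₀ < log(1+√2)` there is `δ > 0` with `χ^{3D,per}_L(x)`
bounded uniformly in `L ≥ L₁`, `x`, and all `βJ∥ ≤ K₀`, `βJ⊥ ≤ δ` (tree: Aizenman–Simon + Onsager make the layer summable).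
[cite: AizenmanSimon1980RotorIsing, eq. (2); Lieb1980, eq. (23) and p. 128 (boxes; finite algorithm)] -/
theorem exists_torus_susceptibility_bound_of_lt_log_one_add_sqrt_two {K₀ : ℝ} (hK0 : 0 ≤ K₀)
    (hK : K₀ < Real.log (1 + Real.sqrt 2)) :
    ∃ (δ C : ℝ) (L₁ : ℕ), 0 < δ ∧ 0 ≤ C ∧
      ∀ β Jp Jz : ℝ, 0 ≤ β → 0 ≤ Jp → 0 ≤ Jz → β * Jp ≤ K₀ → β * Jz ≤ δ →
        ∀ (L : ℕ) [NeZero L], L₁ ≤ L → ∀ x : TorusSite 3 L,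
          ∑ y : TorusSite 3 L, corr (layeredCoupling (β * Jp) (β * Jz)) x y ≤ C :=
  exists_torus_susceptibility_bound_of_summable_layer hK0 (summable_infTwoPoint_of_lt_log_one_add_sqrt_two hK0 hK)

end FreeToPeriodic

/-! ## §4 Long-range order makes the periodic susceptibility diverge -/

section LRO

/-- **A plateau floor forces a large row**: if `δ ≤ plateau_L(K)` then some row of the periodic susceptibility is
`≥ δ·L³` (`plateau_L = L⁻⁶ ∑_x ∑_y corr`, pigeonhole over the `L³` rows). [cite: FriedliVelenikSMLS2017, (10.39)–(10.42) (the plateau)] -/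
theorem exists_sum_corr_ge_of_le_plateau {K : Fin 3 → ℝ} {δ : ℝ} (h : δ ≤ plateau L K) :
    ∃ x : TorusSite 3 L, δ * (L : ℝ) ^ 3 ≤ ∑ y : TorusSite 3 L, corr K x y := by
  classical
  by_contra hcon
  push Not at hcon
  have hL0 : (0 : ℝ) < (L : ℝ) := by exact_mod_cast Nat.pos_of_ne_zero (NeZero.ne L)
  have hcard : (Finset.univ : Finset (TorusSite 3 L)).card = L ^ 3 := by
    rw [Finset.card_univ, card_torusSite]
  have hlt : ∑ x : TorusSite 3 L, ∑ y : TorusSite 3 L, corr K x y < ∑ _x : TorusSite 3 L, δ * (L : ℝ) ^ 3 :=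
    Finset.sum_lt_sum_of_nonempty Finset.univ_nonempty fun x _ => hcon x
  rw [Finset.sum_const, hcard, nsmul_eq_mul] at hlt
  have hplat : plateau L K < δ := by
    unfold plateau
    rw [div_lt_iff₀ (by positivity)]
    calc ∑ x : TorusSite 3 L, ∑ y : TorusSite 3 L, corr K x y < ((L ^ 3 : ℕ) : ℝ) * (δ * (L : ℝ) ^ 3) := hlt
      _ = δ * (L : ℝ) ^ 6 := by push_cast; ring
  exact absurd h (not_le.2 hplat)

/-- **Torus long-range order from the reflection-positivity floor makes the periodic susceptibility exceed every bound**: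
for `0 < K⊥ ≤ K∥` with `1 − (1 + ln(K∥/K⊥)/(2π))/K∥ > 0` (the Fröhlich–Israel–Lieb–Simon / Kennedy–Lieb–Shastry floor of
`layered_longRangeOrder_log`), for every `B` and `L₀` there are an even `L ≥ L₀` and a site `x` with
`χ^{3D,per}_L(x) = ∑_y corr (K∥, K∥, K⊥) x y > B`. [cite: FILS1978, Thms. 4.6–4.7 and (4.6)–(4.10) (anisotropic Gaussian domination); KLS1988PRL, eq. (7); FriedliVelenikSMLS2017, Thm. 10.25] -/
theorem torus_susceptibility_unbounded_of_log_floor {Kp Kz : ℝ} (hz : 0 < Kz) (hle : Kz ≤ Kp)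
    (hfloor : 0 < 1 - (1 + Real.log (Kp / Kz) / (2 * Real.pi)) / Kp) (B : ℝ) (L₀ : ℕ) :
    ∃ (L : ℕ) (_ : NeZero L) (x : TorusSite 3 L), L₀ ≤ L ∧
      B < ∑ y : TorusSite 3 L, corr (layeredCoupling Kp Kz) x y := by
  set c : ℝ := 1 - (1 + Real.log (Kp / Kz) / (2 * Real.pi)) / Kp with hc
  -- the floor with `ε = c/2`: eventually `plateau ≥ c/2`
  obtain ⟨L₁, hL₁⟩ := layered_longRangeOrder_log hz hle (half_pos hfloor)
  -- choose an even `L ≥ max L₀ L₁ 4` with `(c/2)·L³ > B`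
  obtain ⟨N, hN⟩ := exists_nat_gt (max B 0 / (c / 2))
  set L : ℕ := 2 * (max (max L₀ L₁) (max N 2)) with hLdef
  have hLeven : Even L := ⟨max (max L₀ L₁) (max N 2), by rw [hLdef]; ring⟩
  have hL0 : L₀ ≤ L := by
    have := le_max_left (max L₀ L₁) (max N 2); have := le_max_left L₀ L₁; omega
  have hL1 : L₁ ≤ L := by
    have := le_max_left (max L₀ L₁) (max N 2); have := le_max_right L₀ L₁; omega
  have hL4 : 4 ≤ L := by
    have := le_max_right (max L₀ L₁) (max N 2); have := le_max_right N 2; omega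
  have hNL : N ≤ L := by
    have := le_max_right (max L₀ L₁) (max N 2); have := le_max_left N 2; omega
  haveI : NeZero L := ⟨by omega⟩
  have hpl : c / 2 ≤ plateau L (layeredCoupling Kp Kz) := by
    have h := hL₁ L hL1 hLeven hL4
    rw [hc]; linarith
  obtain ⟨x, hx⟩ := exists_sum_corr_ge_of_le_plateau hpl
  refine ⟨L, inferInstance, x, hL0, lt_of_lt_of_le ?_ hx⟩
  -- `B < (c/2)·L³` since `L ≥ N > max B 0 / (c/2)` and `L³ ≥ L`
  have hc2 : 0 < c / 2 := half_pos hfloor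
  have hLr : (N : ℝ) ≤ (L : ℝ) := by exact_mod_cast hNL
  have hL1r : (1 : ℝ) ≤ (L : ℝ) := by exact_mod_cast (show 1 ≤ L by omega)
  have hB : max B 0 < c / 2 * (L : ℝ) := by
    have := (div_lt_iff₀ hc2).1 (hN.trans_le hLr)
    linarith [this]
  calc B ≤ max B 0 := le_max_left _ _
    _ < c / 2 * (L : ℝ) := hB
    _ ≤ c / 2 * (L : ℝ) ^ 3 := by
        refine mul_le_mul_of_nonneg_left ?_ hc2.le
        calc (L : ℝ) = (L : ℝ) ^ 1 := (pow_one _).symm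
          _ ≤ (L : ℝ) ^ 3 := pow_le_pow_right₀ hL1r (by norm_num)

end LRO

end AnisotropicRotator

end Literature.Probability.LatticeModels

end
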